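import Summits.Parity.GeneralizedHardyLittlewood.Theorems.LeeYangFibresCellParityLawP2Defs
import Summits.Parity.GeneralizedHardyLittlewood.Theorems.LeeYangFibresCellParityLawFibreInheritanceAux
import HarnessLib

/-!
# Route `LeeYangFibres`, crux `CellParityLaw` (stmt-Parity-14109), line `section-annihilator`:
# tools for the induction `KernelInduction` (skeleton v18) — the fibres' data

Skeleton v18 (lead c5). For the induction step `C_{n+1}(𝒜; x, z) = Σ_{z<p} C_n(𝒜_p; x/p, p − 1/2)` the law
`Q(n)` is applied to the fibres `𝒜_p` at scale `x_p = x/p`, threshold `z_p = p − 1/2` and deficit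
`η_p = η log x/log(x/p)`. This file records the elementary facts about that data (`FibreDataAux`):

* `primesProdBelow (p − 1/2) = primesProdBelow p` (so `V(z_p) = V(p)`), and the fibre's prime scale
  `T(𝒜_p; x_p, z_p) = e^γ V(p) A_p(x)/u_p^s`, `u_p^s = log(x/p)/log(p − 1/2)`, `A_p(x) = Σ_{n ≤ x, p ∣ n} a_n`;
* the ranges of the fibre data: for `n ≥ 2`, `z < p ≤ x^{1/(n+1)}` and `x` large, `x_p^{1/(u+1)} ≤ z_p ≤ x_p^{1/2}`,
  `x_p ≥ x^{2/3}`, `(log x_p)^{-1/2} ≤ η_p ≤ (3/2) η`, `x_p^{η_p} = x^η`;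
* the shift `0 ≤ u_p^s − u_p ≤ 4 u_p^s/p` between `u_p^s` and `u_p = log(x/p)/log p`, and `1 ≤ u_p ≤ u_p^s`;
* `Σ_{z < p ≤ x^{1/2}} |r_p(x)| ≤ R` from the strong Type-I bound.

References: E. Bombieri, RIMS Kôkyûroku 294 (1977) [BombieriRIMS1977].
-/

noncomputable section

open scoped BigOperators Classical
open Finset Literature.NumberTheory.Sieve

namespace Summit.Parity.GeneralizedHardyLittlewood.Cruxes.CellParityLaw.SectionAnnihilator

namespace FibreDataAux

/-- `⌈p − 1/2⌉₊ = p` for a natural number `p ≥ 1`. [folklore] -/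
theorem ceil_sub_half {p : ℕ} (hp : 1 ≤ p) : ⌈(p : ℝ) - 1 / 2⌉₊ = p := by
  refine le_antisymm ?_ ?_
  · exact Nat.ceil_le.mpr (by linarith)
  · have h : ((p - 1 : ℕ) : ℝ) < (p : ℝ) - 1 / 2 := by
      rw [Nat.cast_sub hp]; push_cast; linarith
    have := Nat.lt_ceil.mpr h
    omega

/-- `P(p − 1/2) = P(p)`: the primes below the real `p − 1/2` are the primes `< p`. [folklore] -/
theorem primesProdBelow_sub_half {p : ℕ} (hp : 1 ≤ p) :
    primesProdBelow ((p : ℝ) - 1 / 2) = primesProdBelow (p : ℝ) := by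
  unfold primesProdBelow
  rw [ceil_sub_half hp, Nat.ceil_natCast]

/-- The fibre's size at `x/p` is `A_p(x)`. -/
theorem fibreSeq_size_div (𝒜 : SieveSequence) {p : ℕ} (hp : 0 < p) (x : ℝ) :
    (fibreSeq 𝒜 p).size (x / p) = 𝒜.congrSum p x := by
  have hp0 : (p : ℝ) ≠ 0 := by exact_mod_cast hp.ne'
  rw [FibreInheritanceAux.fibreSeq_size, FibreInheritanceAux.fibreSeq_congrSum 𝒜 hp, mul_one,
    mul_div_cancel₀ x hp0]

/-- **The fibre's prime scale**: `T(𝒜_p; x/p, p − 1/2) = e^γ V(p) A_p(x) / (log(x/p)/log(p − 1/2))`. -/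
theorem fibre_primeMain (𝒜 : SieveSequence) {p : ℕ} (hp : 0 < p) (x : ℝ) :
    primeMain (fibreSeq 𝒜 p) (x / p) ((p : ℝ) - 1 / 2) =
      Real.exp Real.eulerMascheroniConstant * 𝒜.densityProduct (primesProdBelow (p : ℝ)) *
        𝒜.congrSum p x / (Real.log (x / p) / Real.log ((p : ℝ) - 1 / 2)) := by
  unfold primeMain
  rw [fibreSeq_size_div 𝒜 hp, primesProdBelow_sub_half hp]
  rfl

/-! ### Ranges of the fibre data -/

/-- `x_p^{η_p} = x^η`: `(x/p)^{η log x/log(x/p)} = x^η` for `0 < p < x`. -/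
theorem fibre_rpow_eta {x p η : ℝ} (hx : 0 < x) (hp : 0 < p) (hpx : p < x) :
    (x / p) ^ (η * Real.log x / Real.log (x / p)) = x ^ η := by
  have hxp : 0 < x / p := div_pos hx hp
  have hl : Real.log (x / p) ≠ 0 := (Real.log_pos ((one_lt_div hp).mpr hpx)).ne'
  rw [Real.rpow_def_of_pos hxp, Real.rpow_def_of_pos hx]
  congr 1
  field_simp

/-- For `p ≤ x^{1/3}` (`x ≥ 1`, `p ≥ 1`): `x^{2/3} ≤ x/p` and `log(x/p) ≥ (2/3) log x`. -/
theorem two_thirds_le_log_div {x p : ℝ} (hx : 1 ≤ x) (hp : 1 ≤ p) (hpx : p ≤ x ^ (1 / 3 : ℝ)) :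
    x ^ (2 / 3 : ℝ) ≤ x / p ∧ 2 / 3 * Real.log x ≤ Real.log (x / p) := by
  have hx0 : 0 < x := by linarith
  have hp0 : 0 < p := by linarith
  have h1 : x ^ (2 / 3 : ℝ) ≤ x / p := by
    rw [le_div_iff₀ hp0]
    calc x ^ (2 / 3 : ℝ) * p ≤ x ^ (2 / 3 : ℝ) * x ^ (1 / 3 : ℝ) := by gcongr
      _ = x := by rw [← Real.rpow_add hx0]; norm_num
  refine ⟨h1, ?_⟩
  have h2 := Real.log_le_log (Real.rpow_pos_of_pos hx0 _) h1
  rwa [Real.log_rpow hx0] at h2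

/-- **Deficit of the fibre**: `η_p = η log x/log(x/p)` satisfies `η ≤ η_p ≤ (3/2) η` and
`(log(x/p))^{-1/2} ≤ η_p` when `(log x)^{-1/2} ≤ η`, `0 ≤ η`, `1 < p ≤ x^{1/3}`, `x ≥ 1`. -/
theorem fibre_eta_bounds {x p η : ℝ} (hx : 1 < x) (hp : 1 < p) (hpx : p ≤ x ^ (1 / 3 : ℝ))
    (hη0 : 0 ≤ η) (hηlow : Real.log x ^ (-(1 / 2 : ℝ)) ≤ η) :
    η ≤ η * Real.log x / Real.log (x / p) ∧ η * Real.log x / Real.log (x / p) ≤ 3 / 2 * η ∧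
      Real.log (x / p) ^ (-(1 / 2 : ℝ)) ≤ η * Real.log x / Real.log (x / p) := by
  have hx0 : 0 < x := by linarith
  have hp0 : 0 < p := by linarith
  obtain ⟨-, hl⟩ := two_thirds_le_log_div hx.le hp.le hpx
  have hlx : 0 < Real.log x := Real.log_pos hx
  -- `p < x` (since `x^{1/3} < x` for `x > 1`)
  have hpx' : p < x := by
    calc p ≤ x ^ (1 / 3 : ℝ) := hpx
      _ < x ^ (1 : ℝ) := Real.rpow_lt_rpow_of_exponent_lt hx (by norm_num)
      _ = x := Real.rpow_one x
  have hl0 : 0 < Real.log (x / p) := Real.log_pos ((one_lt_div hp0).mpr hpx')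
  have hllx : Real.log (x / p) ≤ Real.log x := by
    rw [Real.log_div hx0.ne' hp0.ne']; linarith [Real.log_pos hp]
  refine ⟨?_, ?_, ?_⟩
  · rw [le_div_iff₀ hl0]
    exact mul_le_mul_of_nonneg_left hllx hη0
  · rw [div_le_iff₀ hl0]
    nlinarith
  · -- `l^{-1/2} ≤ η lx / l` ⟸ `l^{1/2} ≤ lx^{1/2} ≤ η lx`
    rw [le_div_iff₀ hl0]
    have e1 : Real.log (x / p) ^ (-(1 / 2 : ℝ)) * Real.log (x / p) = Real.log (x / p) ^ (1 / 2 : ℝ) := by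
      rw [← Real.rpow_add_one hl0.ne']; norm_num
    rw [e1]
    have e2 : Real.log x ^ (-(1 / 2 : ℝ)) * Real.log x = Real.log x ^ (1 / 2 : ℝ) := by
      rw [← Real.rpow_add_one hlx.ne']; norm_num
    calc Real.log (x / p) ^ (1 / 2 : ℝ) ≤ Real.log x ^ (1 / 2 : ℝ) :=
          Real.rpow_le_rpow hl0.le hllx (by norm_num)
      _ = Real.log x ^ (-(1 / 2 : ℝ)) * Real.log x := e2.symm
      _ ≤ η * Real.log x := mul_le_mul_of_nonneg_right hηlow hlx.le

/-- **Thresholds of the fibre**: for `n ≥ 2`, `x^{1/(u+1)} ≤ z < p ≤ x^{1/(n+1)}` with `2^{(u+1)²+ (u+1)} ≤ x`: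
`(x/p)^{1/(u+1)} ≤ p − 1/2 ≤ (x/p)^{1/2}`. -/
theorem fibre_threshold_range {u n : ℕ} (hu : 2 ≤ u) (hn : 2 ≤ n) {x z p : ℝ}
    (hx : (2 : ℝ) ^ ((u + 1) ^ 2 + (u + 1)) ≤ x) (hz : x ^ (1 / ((u : ℝ) + 1)) ≤ z) (hzp : z < p)
    (hpx : p ≤ x ^ (1 / ((n : ℝ) + 1))) (hp2 : 2 ≤ p) :
    (x / p) ^ (1 / ((u : ℝ) + 1)) ≤ p - 1 / 2 ∧ p - 1 / 2 ≤ (x / p) ^ (1 / 2 : ℝ) := by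
  have hx1 : 1 < x := by
    have : (2 : ℝ) ≤ (2 : ℝ) ^ ((u + 1) ^ 2 + (u + 1)) := le_self_pow₀ (by norm_num) (by positivity)
    linarith
  have hx0 : 0 < x := by linarith
  have hp0 : 0 < p := by linarith
  have hu1 : (0 : ℝ) < (u : ℝ) + 1 := by positivity
  have hxp0 : 0 < x / p := div_pos hx0 hp0
  constructor
  · -- `(x/p)^{1/(u+1)} ≤ p/2 ≤ p − 1/2`: `x/p ≤ (p/2)^{u+1}` ⟸ `x ≤ p^{u+2}/2^{u+1}` ⟸ `p ≥ x^{1/(u+1)}`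
    have hpz : x ^ (1 / ((u : ℝ) + 1)) ≤ p := hz.trans hzp.le
    have h2 : (2 : ℝ) ^ ((u : ℝ) + 1) ≤ x ^ (1 / ((u : ℝ) + 1)) := by
      -- `2^{u+1} ≤ x^{1/(u+1)}` ⟸ `2^{(u+1)^2} ≤ x`
      have h : ((2 : ℝ) ^ ((u : ℝ) + 1)) ^ ((u : ℝ) + 1) ≤ x := by
        rw [← Real.rpow_mul (by norm_num)]
        have : (2 : ℝ) ^ (((u : ℝ) + 1) * ((u : ℝ) + 1)) = (2 : ℝ) ^ ((u + 1) ^ 2) := by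
          rw [← Real.rpow_natCast]; push_cast; ring_nf
        rw [this]
        exact le_trans (pow_le_pow_right₀ (by norm_num) (by omega)) hx
      calc (2 : ℝ) ^ ((u : ℝ) + 1) = (((2 : ℝ) ^ ((u : ℝ) + 1)) ^ ((u : ℝ) + 1)) ^ (1 / ((u : ℝ) + 1)) := by
            rw [← Real.rpow_mul (by positivity), mul_one_div_cancel hu1.ne', Real.rpow_one]
        _ ≤ x ^ (1 / ((u : ℝ) + 1)) := Real.rpow_le_rpow (by positivity) h (by positivity)
    have hp2u : (2 : ℝ) ^ ((u : ℝ) + 1) ≤ p := h2.trans hpz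
    -- `x/p ≤ (p/2)^{u+1}`
    have hkey : x / p ≤ (p / 2) ^ ((u : ℝ) + 1) := by
      rw [div_le_iff₀ hp0, Real.div_rpow hp0.le (by norm_num)]
      -- `x ≤ p^{u+1}/2^{u+1} · p`; from `x^{1/(u+1)} ≤ p`: `x ≤ p^{u+1}`, and `p ≥ 2^{u+1}`
      have hxp : x ≤ p ^ ((u : ℝ) + 1) := by
        calc x = (x ^ (1 / ((u : ℝ) + 1))) ^ ((u : ℝ) + 1) := by
              rw [← Real.rpow_mul hx0.le, one_div_mul_cancel hu1.ne', Real.rpow_one]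
          _ ≤ p ^ ((u : ℝ) + 1) := Real.rpow_le_rpow (by positivity) hpz hu1.le
      rw [div_mul_eq_mul_div, le_div_iff₀ (by positivity)]
      calc x * (2 : ℝ) ^ ((u : ℝ) + 1) ≤ p ^ ((u : ℝ) + 1) * p := by gcongr
        _ = p ^ ((u : ℝ) + 1) * p := rfl
    calc (x / p) ^ (1 / ((u : ℝ) + 1)) ≤ ((p / 2) ^ ((u : ℝ) + 1)) ^ (1 / ((u : ℝ) + 1)) :=
          Real.rpow_le_rpow hxp0.le hkey (by positivity)
      _ = p / 2 := by rw [← Real.rpow_mul (by positivity), mul_one_div_cancel hu1.ne', Real.rpow_one]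
      _ ≤ p - 1 / 2 := by linarith
  · -- `p − 1/2 ≤ p ≤ (x/p)^{1/2}` ⟸ `p^2 ≤ x/p` ⟸ `p^3 ≤ x` ⟸ `p ≤ x^{1/(n+1)} ≤ x^{1/3}`
    have hn1 : (0 : ℝ) < (n : ℝ) + 1 := by positivity
    have hp3 : p ≤ x ^ (1 / 3 : ℝ) := by
      refine hpx.trans (Real.rpow_le_rpow_of_exponent_le hx1.le ?_)
      rw [div_le_div_iff₀ hn1 (by norm_num)]
      have : (2 : ℝ) ≤ n := by exact_mod_cast hn
      linarith
    have hp3' : p ^ (3 : ℝ) ≤ x := by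
      calc p ^ (3 : ℝ) ≤ (x ^ (1 / 3 : ℝ)) ^ (3 : ℝ) := Real.rpow_le_rpow hp0.le hp3 (by norm_num)
        _ = x := by rw [← Real.rpow_mul hx0.le]; norm_num
    have hsq : p ^ (2 : ℝ) ≤ x / p := by
      rw [le_div_iff₀ hp0]
      calc p ^ (2 : ℝ) * p = p ^ (3 : ℝ) := by
            rw [← Real.rpow_add_one hp0.ne']; norm_num
        _ ≤ x := hp3'
    calc p - 1 / 2 ≤ p := by linarith
      _ = (p ^ (2 : ℝ)) ^ (1 / 2 : ℝ) := by rw [← Real.rpow_mul hp0.le]; norm_num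
      _ ≤ (x / p) ^ (1 / 2 : ℝ) := Real.rpow_le_rpow (by positivity) hsq (by norm_num)

/-! ### The shift `u_p^s − u_p` -/

/-- For `p ≥ 2` and `p² ≤ x`: `u_p = log(x/p)/log p` and `u_p^s = log(x/p)/log(p − 1/2)` satisfy
`1 ≤ u_p ≤ u_p^s` and `u_p^s − u_p ≤ 4 u_p^s / p`. [`log p − log(p − 1/2) ≤ (1/2)/(p − 1/2) ≤ 1/p`,
`log(p − 1/2) ≥ log(3/2) ≥ 1/4`.] -/
theorem shift_bounds {x p : ℝ} (hp : 2 ≤ p) (hpx : p ^ 2 ≤ x) :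
    1 ≤ Real.log (x / p) / Real.log p ∧
      Real.log (x / p) / Real.log p ≤ Real.log (x / p) / Real.log (p - 1 / 2) ∧
      Real.log (x / p) / Real.log (p - 1 / 2) - Real.log (x / p) / Real.log p ≤
        4 * (Real.log (x / p) / Real.log (p - 1 / 2)) / p := by
  have hp0 : 0 < p := by linarith
  have hph : (3 : ℝ) / 2 ≤ p - 1 / 2 := by linarith
  have hx : p ^ 2 ≤ x := hpx
  have hxp : p ≤ x / p := by rw [le_div_iff₀ hp0]; nlinarith
  have hlp : 0 < Real.log p := Real.log_pos (by linarith)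
  have hlph : 0 < Real.log (p - 1 / 2) := Real.log_pos (by linarith)
  have hl : Real.log p ≤ Real.log (x / p) := Real.log_le_log hp0 hxp
  have hlhp : Real.log (p - 1 / 2) ≤ Real.log p := Real.log_le_log (by linarith) (by linarith)
  have hL0 : 0 ≤ Real.log (x / p) := hlp.le.trans hl
  refine ⟨?_, ?_, ?_⟩
  · rwa [le_div_iff₀ hlp, one_mul]
  · exact div_le_div_of_nonneg_left hL0 hlph hlhp
  · -- `L/lh − L/lp = L (lp − lh)/(lp lh) ≤ (L/lh) · (1/p)/lp · …`
    set L := Real.log (x / p) with hLdef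
    have hdiff : Real.log p - Real.log (p - 1 / 2) ≤ 1 / p := by
      have h := Real.log_le_sub_one_of_pos (show 0 < p / (p - 1 / 2) by positivity)
      rw [Real.log_div hp0.ne' (by linarith)] at h
      have hne : (p - 1 / 2) ≠ 0 := by linarith
      have e : p / (p - 1 / 2) - 1 = (1 / 2) / (p - 1 / 2) := by
        rw [div_sub_one hne]; congr 1; ring
      rw [e] at h
      calc Real.log p - Real.log (p - 1 / 2) ≤ 1 / 2 / (p - 1 / 2) := h
        _ ≤ 1 / p := by rw [div_le_div_iff₀ (by linarith) hp0]; linarith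
    have hlh4 : 1 / 4 ≤ Real.log (p - 1 / 2) := by
      -- `log(3/2) ≥ 1 - 2/3 = 1/3 ≥ 1/4`
      have h := Real.add_one_le_exp (1 / 4 : ℝ)
      have h32 : Real.exp (1 / 4 : ℝ) ≤ 3 / 2 := by
        have := Real.exp_one_lt_d9
        have hmono : Real.exp (1 / 4 : ℝ) ≤ Real.exp 1 ^ (1 : ℕ) := by
          rw [pow_one]; exact Real.exp_le_exp.mpr (by norm_num)
        -- crude: exp(1/4) = (exp 1)^{1/4} ≤ 2.72^{1/4} < 1.5; use exp(1/4)^4 = e ≤ (3/2)^4 = 5.06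
        have h4 : Real.exp (1 / 4 : ℝ) ^ 4 = Real.exp 1 := by
          rw [← Real.exp_nat_mul]; norm_num
        by_contra hcon
        push Not at hcon
        have : (3 / 2 : ℝ) ^ 4 < Real.exp (1 / 4 : ℝ) ^ 4 := by gcongr
        rw [h4] at this
        norm_num at this
        linarith
      calc (1 / 4 : ℝ) ≤ Real.log (Real.exp (1 / 4)) := by rw [Real.log_exp]
        _ ≤ Real.log (p - 1 / 2) := Real.log_le_log (Real.exp_pos _) (h32.trans hph)
    have e : L / Real.log (p - 1 / 2) - L / Real.log p =
        L / Real.log (p - 1 / 2) * ((Real.log p - Real.log (p - 1 / 2)) / Real.log p) := by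
      rw [div_sub_div _ _ hlph.ne' hlp.ne', div_mul_div_comm]
      congr 1; ring
    rw [e]
    have hq : (Real.log p - Real.log (p - 1 / 2)) / Real.log p ≤ 4 / p := by
      rw [div_le_div_iff₀ hlp hp0]
      have h1 : (Real.log p - Real.log (p - 1 / 2)) * p ≤ 1 := by
        have := mul_le_mul_of_nonneg_right hdiff hp0.le
        rwa [one_div_mul_cancel hp0.ne'] at this
      nlinarith [hlh4.trans hlhp]
    calc L / Real.log (p - 1 / 2) * ((Real.log p - Real.log (p - 1 / 2)) / Real.log p)
        ≤ L / Real.log (p - 1 / 2) * (4 / p) :=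
          mul_le_mul_of_nonneg_left hq (div_nonneg hL0 hlph.le)
      _ = 4 * (L / Real.log (p - 1 / 2)) / p := by ring

/-! ### The Type-I remainders at the primes -/

/-- `Σ_{z < p ≤ P, p prime} |r_p(x)| ≤ R` whenever `P ≤ x^{1−η}` (the primes are squarefree moduli of the
strong Type-I bound, truncation `y = x`). -/
theorem sum_abs_remainder_primes_le (𝒜 : SieveSequence) {x z η R : ℝ} {P : ℕ}
    (hT : StrongTypeI 𝒜 x η R) (hP : (P : ℝ) ≤ x ^ (1 - η)) :
    ∑ p ∈ (Finset.Ioc ⌊z⌋₊ P).filter Nat.Prime, |𝒜.remainder p x| ≤ R := by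
  have h := hT (fun _ => x) fun _ => le_rfl
  refine le_trans (Finset.sum_le_sum_of_subset_of_nonneg ?_ fun _ _ _ => abs_nonneg _) h
  intro p hp
  simp only [Finset.mem_filter, Finset.mem_Ioc] at hp ⊢
  obtain ⟨⟨_, hpP⟩, hpp⟩ := hp
  refine ⟨Finset.mem_Icc.mpr ⟨hpp.one_lt.le, ?_⟩, hpp.squarefree⟩
  exact Nat.le_floor ((show ((p : ℕ) : ℝ) ≤ (P : ℝ) by exact_mod_cast hpP).trans hP)

/-- **`stub_buchstabShift`** (registered auxiliary sub-goal of stmt-Parity-14109, tools of the induction of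
skeleton v18): the shift between the fibre's two roughness parameters, `u_p^s − u_p ≤ 4 u_p^s/p` and
`1 ≤ u_p ≤ u_p^s`, for `p ≥ 2`, `p² ≤ x`. -/
theorem stub_buchstabShift : ∀ x p : ℝ, 2 ≤ p → p ^ 2 ≤ x →
    1 ≤ Real.log (x / p) / Real.log p ∧
      Real.log (x / p) / Real.log p ≤ Real.log (x / p) / Real.log (p - 1 / 2) ∧
      Real.log (x / p) / Real.log (p - 1 / 2) - Real.log (x / p) / Real.log p ≤
        4 * (Real.log (x / p) / Real.log (p - 1 / 2)) / p :=
  fun _ _ hp hpx => shift_bounds hp hpx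

end FibreDataAux

end Summit.Parity.GeneralizedHardyLittlewood.Cruxes.CellParityLaw.SectionAnnihilator

end
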